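import Literature.AlgebraicTopology.SingularHomology.SphereLikeFibre
import Literature.AlgebraicTopology.SingularHomology.CohomologyRingChangeRelative
import HarnessLib

/-!
# Change of coefficients in `H^*(U × C)`, `H^*(U × P)` for circle- and sphere-like `C`, `P`; `f_* ω(m) = ω(f m)`

A. Hatcher, *Algebraic Topology* (2002), §3.1 p. 198 (change of coefficients along a ring
homomorphism `f : R → S`, natural with respect to all the maps of §3.1: induced maps, the coboundary
of a pair, excision) applied to the tree's computation of the cohomology of `U × C` and `U × P` for
circle-like `C` and sphere-like `P` (`TwoPieceProductCohomology`, `CircleLikeProductCohomology`,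
`SphereLikeProductCohomology`, `SphereLikeFibre`; Hatcher §3.1 pp. 199–202). Every map of that
computation commutes with `f_*` (`singularCohomology.ringChange f`, and its relative version
`relSingularCohomology.ringChange f` of `CohomologyRingChangeRelative`):

* `ringChange_twoPieceKappa` — `κ = j ∘ exc⁻¹ ∘ δ` (coboundary, inverse excision, forget the pair);
* `IsCircleLike.ringChange_extPlus`, `IsCircleLike.ringChange_circleMap` — the extension `ext₊`
  (detected by the restrictions to the two pieces) and `circleMap (y, c) = pr₁^* y + κ(ext₊ c)`;
* `IsSphereLike.ringChange_sigmaMap`, `IsSphereLike.ringChange_sphereMap`;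
* `ringChange_constClass` — `f_*(m·1) = f(m)·1` in `H⁰`;
* **`IsSphereLike.ringChange_omegaProd`, `IsSphereLike.ringChange_omegaFibre`: `f_* ω(m) = ω(f m)`** —
  the canonical generator `ω(1) ∈ H²(P; R)` of a sphere-like space (e.g. `ℂP¹`) is NATURAL IN THE
  COEFFICIENT RING. This is the input for the compatibility of the tree's Thom / Euler / Chern
  classes (normalised by `ω`) with change of coefficients (`CharacteristicClasses.ChernClassRingChange`).

Everything is proved; no named facts.

## References

* A. Hatcher, *Algebraic Topology*, CUP 2002, §3.1 p. 198 and pp. 199–202. [HatcherAT2002]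
-/

noncomputable section

open CategoryTheory Set

universe u v

namespace Literature.AlgebraicTopology.SingularHomology

open singularCochainComplex

variable {R S : Type v} [CommRing R] [CommRing S] (f : R →+* S)
variable {U : Type u} {Y : Type u} [TopologicalSpace U] [TopologicalSpace Y]

/-- `f_*` commutes with induced maps (universe-polymorphic copy of
`CharacteristicClasses.ringChange_map`, on representing cocycles). [folklore] -/
private theorem ringChange_map' {X X' : Type u} [TopologicalSpace X] [TopologicalSpace X'] (g : C(X, X')) (n : ℕ)
    (x : singularCohomology R R X' n) :
    singularCohomology.ringChange f X n (singularCohomology.map R R g n x) =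
      singularCohomology.map S S g n (singularCohomology.ringChange f X' n x) := by
  induction x using singularCohomology_induction_on with
  | h w =>
    rw [singularCohomology.map_π, singularCohomology.ringChange_π, singularCohomology.ringChange_π,
      singularCohomology.map_π]
    congr 1
    refine coFn_injective ?_
    rw [coFn_cocyclesRingChange, coFn_cocyclesMap, coFn_cocyclesMap, coFn_cocyclesRingChange]
    rfl

/-! ### The map `κ` of a two-piece cover -/

section TwoPiece

variable {Y₁ Y₂ : Set Y} (h₁ : IsOpen Y₁) (h₂ : IsOpen Y₂) (hcov : Y₁ ∪ Y₂ = univ)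

/-- `f_*` commutes with the excision map `Hⁿ(U × Y, U × Y₁) → Hⁿ(U × Y₂, U × (Y₁ ∩ Y₂))` (a map of
pairs). [cite: HatcherAT2002, §3.1 p. 201] -/
theorem ringChange_excMap (n : ℕ) (r : relSingularCohomology R R (U × Y) (vert U Y₁) n) :
    relSingularCohomology.ringChange f _ _ n (excMap R R Y₁ Y₂ n r) =
      excMap S S Y₁ Y₂ n (relSingularCohomology.ringChange f _ _ n r) :=
  relSingularCohomology.ringChange_map f _ _ r

include h₁ h₂ hcov in
/-- **`f_* ∘ κ = κ ∘ f_*`** for `κ = j ∘ exc⁻¹ ∘ δ : Hⁱ(U × (Y₁ ∩ Y₂)) → Hⁱ⁺¹(U × Y)`: each of the three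
maps commutes with the change of coefficients (for `exc⁻¹`, compare after applying the excision
isomorphism). [cite: HatcherAT2002, §3.1 pp. 198–201] -/
theorem ringChange_twoPieceKappa (i : ℕ) (a : singularCohomology R R ↥(inter U Y₁ Y₂) i) :
    singularCohomology.ringChange f (U × Y) (i + 1) (twoPieceKappa R R h₁ h₂ hcov i a) =
      twoPieceKappa S S h₁ h₂ hcov i (singularCohomology.ringChange f ↥(inter U Y₁ Y₂) i a) := by
  haveI := isIso_excMap R R (U := U) h₁ h₂ hcov (i + 1)
  haveI := isIso_excMap S S (U := U) h₁ h₂ hcov (i + 1)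
  rw [twoPieceKappa_apply, twoPieceKappa_apply, relSingularCohomology.ringChange_toAbsolute]
  congr 1
  have hinj : Function.Injective (excMap S S (U := U) Y₁ Y₂ (i + 1)) := fun r r' hrr' ↦ by
    rw [← inv_excMap_apply_excMap S S (Y₂ := Y₂) (i + 1) r, hrr', inv_excMap_apply_excMap]
  apply hinj
  rw [excMap_apply_inv_excMap, ← ringChange_excMap, excMap_apply_inv_excMap, relSingularCohomology.ringChange_δ]

end TwoPiece

/-! ### Circle-like spaces -/

namespace IsCircleLike

variable {Y₁ Y₂ Zp Zm : Set Y} (hY : IsCircleLike Y Y₁ Y₂ Zp Zm)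
include hY

/-- **`f_* (ext₊ c) = ext₊ (f_* c)`**: both sides restrict to `pr^*(f_* c)` on `U × Z₊` and to `0` on
`U × Z₋`. [cite: HatcherAT2002, §3.1 p. 202] -/
theorem ringChange_extPlus (j : ℕ) (c : singularCohomology R R U j) :
    singularCohomology.ringChange f _ j ((hY.extPlus R R j) c) = (hY.extPlus S S j) (singularCohomology.ringChange f U j c) := by
  refine hY.eq_of_map_pieces_eq S S ?_ ?_
  · rw [← ringChange_map', hY.map_plus_extPlus R R, hY.map_plus_extPlus S S, ringChange_map']
  · rw [← ringChange_map', hY.map_minus_extPlus R R, hY.map_minus_extPlus S S, map_zero]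

/-- **`f_* circleMap (y, c) = circleMap (f_* y, f_* c)`.** [cite: HatcherAT2002, §3.1 pp. 198–202] -/
theorem ringChange_circleMap (i : ℕ) (y : singularCohomology R R U (i + 1)) (c : singularCohomology R R U i) :
    singularCohomology.ringChange f (U × Y) (i + 1) ((hY.circleMap R R i) (y, c)) =
      (hY.circleMap S S i) (singularCohomology.ringChange f U (i + 1) y, singularCohomology.ringChange f U i c) := by
  rw [hY.circleMap_apply R R, hY.circleMap_apply S S, map_add, ringChange_map',
    ringChange_twoPieceKappa f hY.isOpen_left hY.isOpen_right hY.union_eq, hY.ringChange_extPlus]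

end IsCircleLike

/-! ### Sphere-like spaces; the constant classes; `ω` -/

/-- **`f_*(m·1) = f(m)·1` in `H⁰(X)`** (the constant cocycle `m` goes to the constant cocycle `f m`).
[cite: HatcherAT2002, §3.1 p. 198] -/
theorem ringChange_constClass (X : Type u) [TopologicalSpace X] (m : R) :
    singularCohomology.ringChange f X 0 (constClass (R := R) R X m) = constClass (R := S) S X (f m) := by
  rw [constClass, constClass, singularCohomology.ringChange_homologyCls f _ _
    (singularCochainComplex.d_next_comp_ringHom_eq_zero f (d_constCochain R R X m))]
  exact homologyCls_congr rfl _ _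

namespace IsSphereLike

variable {A₁ A₂ : Set Y} {W₁ W₂ Vp Vm : Set ↥(A₁ ∩ A₂)} (hY : IsSphereLike Y A₁ A₂ W₁ W₂ Vp Vm)
include hY

/-- **`f_* (σ c) = σ (f_* c)`** for `σ c = κ(T(circleMap (0, c)))`. [cite: HatcherAT2002, §3.1 pp. 198–202] -/
theorem ringChange_sigmaMap (i : ℕ) (c : singularCohomology R R U i) :
    singularCohomology.ringChange f (U × Y) (i + 2) ((hY.sigmaMap R R i) c) =
      (hY.sigmaMap S S i) (singularCohomology.ringChange f U i c) := by
  rw [hY.sigmaMap_apply R R, hY.sigmaMap_apply S S,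
    ringChange_twoPieceKappa f hY.isOpen_left hY.isOpen_right hY.union_eq]
  change twoPieceKappa S S _ _ _ (i + 1) (singularCohomology.ringChange f _ (i + 1)
    (singularCohomology.map R R (interHomeomorph U A₁ A₂ : C(↥(inter U A₁ A₂), U × ↥(A₁ ∩ A₂))) (i + 1)
      ((hY.circleLike.circleMap R R (U := U) i) (0, c)))) = _
  rw [ringChange_map', hY.circleLike.ringChange_circleMap, map_zero]

/-- **`f_* sphereMap (y, c) = sphereMap (f_* y, f_* c)`.** [cite: HatcherAT2002, §3.1 pp. 198–202] -/
theorem ringChange_sphereMap (i : ℕ) (y : singularCohomology R R U (i + 2)) (c : singularCohomology R R U i) :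
    singularCohomology.ringChange f (U × Y) (i + 2) ((hY.sphereMap R R i) (y, c)) =
      (hY.sphereMap S S i) (singularCohomology.ringChange f U (i + 2) y, singularCohomology.ringChange f U i c) := by
  rw [hY.sphereMap_apply R R, hY.sphereMap_apply S S, map_add, ringChange_map', hY.ringChange_sigmaMap]

/-- **`f_* ω_U(m) = ω_U(f m)`.** [cite: HatcherAT2002, §3.1 pp. 198–202] -/
theorem ringChange_omegaProd (U : Type u) [TopologicalSpace U] (m : R) :
    singularCohomology.ringChange f (U × Y) 2 (hY.omegaProd R R U m) = hY.omegaProd S S U (f m) := by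
  rw [IsSphereLike.omegaProd, IsSphereLike.omegaProd, hY.ringChange_sphereMap, map_zero, ringChange_constClass]

/-- **`f_* ω(m) = ω(f m)` in `H²(P; S)`**: the canonical generator of the degree-two cohomology of a
sphere-like space is natural in the coefficient ring (in particular `f_* ω(1) = ω(1)`).
[cite: HatcherAT2002, §3.1 p. 198 and pp. 199–202] -/
theorem ringChange_omegaFibre (m : R) :
    singularCohomology.ringChange f Y 2 (hY.omegaFibre R R m) = hY.omegaFibre S S (f m) := by
  rw [IsSphereLike.omegaFibre, IsSphereLike.omegaFibre, ringChange_map', hY.ringChange_omegaProd]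

end IsSphereLike

end Literature.AlgebraicTopology.SingularHomology
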